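import Literature.Analysis.FluidPDE.TwoHalfWeakLimits
import Literature.Analysis.FluidPDE.CheskidovAssemblyTools
import Literature.Analysis.FluidPDE.WeakSolutionSingularTime
import HarnessLib

/-!
# Cheskidov's no-dissipation-anomaly family: the `2½`-dimensional Euler limit on `T³`

Topic `Literature/Analysis/FluidPDE`. Second half of the `2½`-dimensional assembly of Cheskidov
2023, Thm. 2.1 (second subfamily, `e = 0`) from planar data (see `CheskidovNoAnomalyLift.lean` for
the Navier–Stokes family): the clauses of
`Literature.Barriers.AnomalousDissipation.Cheskidov2023_thm21_noDissipationAnomaly` about the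
limit `u(t) = (ṽ(t), ρ̃(t)) ∘ π` for `t < 1`, `u(t) = 0` for `t ≥ 1`, with force `f = (g, 0)`
(source, (3.10)–(3.11) and §4 p. 12):

* `Cheskidov.isClassicalNSSolutionOn_limit` — `u` is a classical Euler solution on `[0,1) × T³`
  with force `(g, 0)` and zero pressure ((3.11): "`u(t)` is a smooth solution of the Euler
  equations on `[0,1)` … with the force `f = (g,0)`");
* `Cheskidov.intervalIntegrable_power`, `Cheskidov.integral_power_eq_zero` — the power
  `(f, u) = (g, ṽ)` is integrable on `(0,1)` and `∫₀¹ (f, u) = 0` (Lemma 3.2 (3.15); here from the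
  energy balance of the planar Euler solution `ṽ`, `ṽ(0) = 0` and `‖ṽ(t)‖_{L²} → 0` as `t → 1⁻`,
  (3.10));
* `Cheskidov.tendsto_integral_inner_limit` — `u(t) ⇀ 0` weakly in `L²(T³)` as `t → 1⁻`
  ((3.10): `ρ̃(t) ⇀ 0`, `‖ṽ(t)‖_{L²} → 0`);
* `Cheskidov.isWeakNSSolutionForcedOn_limit` — `u` is a weak Euler solution on `[0,2]` with
  force `f` and datum `(0, ρ_in) ∘ π` (§4 p. 12, via the accepted
  `Torus.isWeakNSSolutionForcedOn_of_vanishing`).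

## References

* A. Cheskidov, arXiv:2311.04182 (2023), Thm. 2.1, Lemma 3.2, (3.7)–(3.11), §4 p. 12.
-/

noncomputable section

open MeasureTheory Set Filter UnitAddTorus
open _root_.Topology
open scoped ENNReal NNReal InnerProductSpace
open Literature.Analysis.FunctionSpaces.Torus (twoHalf planarProj planarProjE planarEmbed)

namespace Literature.Analysis.FluidPDE.Cheskidov

open Literature.Analysis.FunctionSpaces

/-- Pairings of `L²` fields are integrable (`|⟪a, w⟫| ≤ ‖a‖‖w‖` and Hölder). [folklore] -/
theorem integrable_inner_of_memLp {X : Type*} [MeasurableSpace X] {μ : Measure X} {E : Type*}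
    [NormedAddCommGroup E] [InnerProductSpace ℝ E] {a w : X → E} (ha : MemLp a 2 μ) (hw : MemLp w 2 μ) :
    Integrable (fun x => ⟪a x, w x⟫_ℝ) μ :=
  (ha.norm.integrable_mul hw.norm).mono' (ha.aestronglyMeasurable.inner hw.aestronglyMeasurable)
    (ae_of_all _ fun x => norm_inner_le_norm (a x) (w x))

section Limit

variable {vt : ℝ → UnitAddTorus (Fin 2) → EuclideanSpace ℝ (Fin 2)} {ρt : ℝ → UnitAddTorus (Fin 2) → ℝ}
  {g : ℝ → UnitAddTorus (Fin 2) → EuclideanSpace ℝ (Fin 2)} {B : ℝ}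

/-- The planar profile `ṽ` is a classical solution of the Euler equations on `[0,1) × T²` with
zero pressure and the force `g := ∂ₜṽ + (ṽ·∇)ṽ` (Cheskidov 2023, (3.11)). [cite: Cheskidov2023, (3.11)] -/
theorem isClassicalNSSolutionOn_profile (hprof : Torus.IsClassicalScalarTransportOn (Ico 0 1) 0 vt ρt)
    (hg : ∀ t ∈ Ico (0 : ℝ) 1, ∀ y, g t y =
      FunctionSpaces.Torus.timeDerivWithin (Ico 0 1) vt t y + FunctionSpaces.Torus.convect (vt t) (vt t) y) :
    FunctionSpaces.Torus.IsClassicalNSSolutionOn (Ico 0 1) 0 g vt (fun _ _ => 0) where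
  smooth_velocity := hprof.smooth_velocity
  smooth_pressure := by
    change ContDiffOn ℝ _ (fun _ => (0 : ℝ)) _
    exact contDiffOn_const
  momentum t ht y := by
    have h0 : FunctionSpaces.Torus.gradient (fun _ : UnitAddTorus (Fin 2) => (0 : ℝ)) y = 0 :=
      gradient_fun_const (0 : EuclideanSpace ℝ (Fin 2)) (0 : ℝ)
    rw [hg t ht y, h0, zero_smul, sub_zero, zero_add]
  divFree t ht := hprof.divFree t ht

/-- **The limit is a classical Euler solution on `[0,1)`**: `u(t) = (ṽ(t), ρ̃(t)) ∘ π` (extended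
by `0` for `t ≥ 1`) solves the Euler equations on `[0,1) × T³` with force `f = (g, 0)` and zero
pressure (Cheskidov 2023, after (3.11): "`u(t)` is a smooth solution of the Euler equations on
`[0,1)` with `u(0) = u_in` … and the force `f = (g,0)`"). [cite: Cheskidov2023, (3.11)] -/
theorem isClassicalNSSolutionOn_limit (hprof : Torus.IsClassicalScalarTransportOn (Ico 0 1) 0 vt ρt)
    (hg : ∀ t ∈ Ico (0 : ℝ) 1, ∀ y, g t y =
      FunctionSpaces.Torus.timeDerivWithin (Ico 0 1) vt t y + FunctionSpaces.Torus.convect (vt t) (vt t) y) :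
    FunctionSpaces.Torus.IsClassicalNSSolutionOn (Ico 0 1) 0 (fun t => twoHalf (g t) 0)
      (fun t => if t < 1 then twoHalf (vt t) (ρt t) else 0)
      (fun _ => (fun _ : UnitAddTorus (Fin 2) => (0 : ℝ)) ∘ planarProj) := by
  have hbase := Torus.isClassicalNSSolutionOn_twoHalf (uniqueDiffOn_Ico 0 1) 0 hprof.smooth_velocity
    hprof.smooth_scalar (FunctionSpaces.Torus.isSmoothSpaceTimeOn_const
      (FunctionSpaces.Torus.isSmooth_const (0 : ℝ)) _) hprof.divFree
  refine hbase.congr (fun t ht => if_pos ht.2) (fun t ht => ?_)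
  funext x
  rw [Torus.twoHalfForce_apply]
  have e1 : ∀ y, FunctionSpaces.Torus.timeDerivWithin (Ico 0 1) vt t y +
      FunctionSpaces.Torus.convect (vt t) (vt t) y - (0 : ℝ) • FunctionSpaces.Torus.laplacian (vt t) y +
      FunctionSpaces.Torus.gradient (fun _ : UnitAddTorus (Fin 2) => (0 : ℝ)) y = g t y := fun y => by
    have h0 : FunctionSpaces.Torus.gradient (fun _ : UnitAddTorus (Fin 2) => (0 : ℝ)) y = 0 :=
      gradient_fun_const (0 : EuclideanSpace ℝ (Fin 2)) (0 : ℝ)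
    rw [hg t ht y, h0, zero_smul, sub_zero, add_zero]
  have e2 : ∀ y, FunctionSpaces.Torus.timeDerivWithin (Ico 0 1) ρt t y +
      ⟪vt t y, FunctionSpaces.Torus.gradient (ρt t) y⟫_ℝ - 0 * FunctionSpaces.Torus.laplacian (ρt t) y = 0 :=
    fun y => by rw [hprof.transport t ht y]; ring
  simp only [twoHalf, e1, e2, Pi.zero_apply]

/-- On `[0,1)` the power `(f(t), u(t)) = ∫ ⟪(g,0)∘π, (ṽ,ρ̃)∘π⟫` is the planar power `∫ ⟪g(t), ṽ(t)⟫`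
(Cheskidov 2023, proof of Lemma 3.2). [cite: Cheskidov2023, Lemma 3.2] -/
theorem power_eq (hprof : Torus.IsClassicalScalarTransportOn (Ico 0 1) 0 vt ρt)
    (hg : ∀ t ∈ Ico (0 : ℝ) 1, ∀ y, g t y =
      FunctionSpaces.Torus.timeDerivWithin (Ico 0 1) vt t y + FunctionSpaces.Torus.convect (vt t) (vt t) y)
    {t : ℝ} (ht : t ∈ Ico (0 : ℝ) 1) :
    ∫ x, ⟪twoHalf (g t) 0 x, (if t < 1 then twoHalf (vt t) (ρt t) else 0) x⟫_ℝ = ∫ y, ⟪g t y, vt t y⟫_ℝ := by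
  have hU : UniqueDiffOn ℝ (Ico (0 : ℝ) 1) := uniqueDiffOn_Ico 0 1
  have hV := hprof.smooth_velocity
  have hgt : FunctionSpaces.Torus.IsSmooth (g t) := by
    have : g t = fun y => FunctionSpaces.Torus.timeDerivWithin (Ico 0 1) vt t y +
        FunctionSpaces.Torus.convect (vt t) (vt t) y := funext (hg t ht)
    rw [this]
    exact (hV.isSmooth_timeDerivWithin hU ht).add ((hV.isSmooth_slice ht).convect (hV.isSmooth_slice ht))
  rw [if_pos ht.2, Torus.integral_inner_twoHalf]
  · simp
  · exact ((hgt.inner (hV.isSmooth_slice ht)).continuous.add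
      (continuous_zero.mul (hprof.smooth_scalar.isSmooth_slice ht).continuous)).aestronglyMeasurable

/-- **Zero work of the limiting force.** The power `t ↦ (f(t), u(t))` of the limit is integrable on
`(0,1)` and `∫₀¹ (f, u) dt = 0` (Cheskidov 2023, Lemma 3.2, (3.15), and Thm. 2.1, (2.1)): on
`[0,1)` it is the planar power `(g, ṽ) = d/dt ½‖ṽ‖²` (energy balance of the classical Euler
solution `ṽ`, accepted `Torus.IsClassicalNSSolutionOn.energy_balance_holds`), `ṽ(0) = 0`, the
power is bounded, and `‖ṽ(t)‖_{L²} → 0` as `t → 1⁻` ((3.10)). [cite: Cheskidov2023, Lemma 3.2 (3.15) and Thm. 2.1 (2.1)] -/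
theorem intervalIntegrable_power_and_integral_eq_zero
    (hprof : Torus.IsClassicalScalarTransportOn (Ico 0 1) 0 vt ρt)
    (hg : ∀ t ∈ Ico (0 : ℝ) 1, ∀ y, g t y =
      FunctionSpaces.Torus.timeDerivWithin (Ico 0 1) vt t y + FunctionSpaces.Torus.convect (vt t) (vt t) y)
    (hB : ∀ t ∈ Ico (0 : ℝ) 1, ∀ y, ‖vt t y‖ ≤ B) (hgB : ∀ t ∈ Icc (0 : ℝ) 2, ∀ y, ‖g t y‖ ≤ B)
    (hvt0 : vt 0 = 0) (hvan : Tendsto (fun t => ∫ y, ‖vt t y‖ ^ 2) (𝓝[<] 1) (𝓝 0)) :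
    IntervalIntegrable (fun t => ∫ x, ⟪twoHalf (g t) 0 x,
        (if t < 1 then twoHalf (vt t) (ρt t) else 0) x⟫_ℝ) volume 0 1 ∧
      (∫ t in (0 : ℝ)..1, ∫ x, ⟪twoHalf (g t) 0 x,
        (if t < 1 then twoHalf (vt t) (ρt t) else 0) x⟫_ℝ) = 0 := by
  set P : ℝ → ℝ := fun t => ∫ x, ⟪twoHalf (g t) 0 x,
    (if t < 1 then twoHalf (vt t) (ρt t) else 0) x⟫_ℝ with hP_def
  have hS : Convex ℝ (Ico (0 : ℝ) 1) := convex_Ico 0 1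
  have hU : UniqueDiffOn ℝ (Ico (0 : ℝ) 1) := uniqueDiffOn_Ico 0 1
  have hV := hprof.smooth_velocity
  have h0mem : (0 : ℝ) ∈ Ico (0 : ℝ) 1 := ⟨le_rfl, one_pos⟩
  have hB0 : 0 ≤ B := (norm_nonneg _).trans (hB 0 h0mem 0)
  -- the planar power and the energy balance of `ṽ`
  have hEul := isClassicalNSSolutionOn_profile hprof hg
  set K : ℝ → ℝ := fun t => FunctionSpaces.Torus.kineticEnergy (vt t) with hK_def
  have hPt : ∀ t ∈ Ico (0 : ℝ) 1, P t = ∫ y, ⟪g t y, vt t y⟫_ℝ := fun t ht => power_eq hprof hg ht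
  have hK : ∀ t ∈ Ico (0 : ℝ) 1, HasDerivWithinAt K (P t) (Ico 0 1) t := by
    intro t ht
    have h := FunctionSpaces.Torus.IsClassicalNSSolutionOn.energy_balance_holds hEul hS ht
    rw [hPt t ht]
    simpa using h
  -- continuity of the planar power on `[0,1)`
  set G : ℝ → UnitAddTorus (Fin 2) → EuclideanSpace ℝ (Fin 2) := fun t y =>
    FunctionSpaces.Torus.timeDerivWithin (Ico 0 1) vt t y + FunctionSpaces.Torus.convect (vt t) (vt t) y with hG_def
  have hGs : FunctionSpaces.Torus.IsSmoothSpaceTimeOn (Ico 0 1) G :=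
    (hV.timeDerivWithin hU).add (hV.convect hV hU)
  have hPc : ContinuousOn P (Ico 0 1) := by
    refine ((hGs.inner hV).continuousOn_integral hS).congr fun t ht => ?_
    rw [hPt t ht]
    refine integral_congr_ae (ae_of_all _ fun y => ?_)
    simp only [hG_def, hg t ht y]
  -- the power is bounded on `[0,1)`
  have hPb : ∀ t ∈ Ico (0 : ℝ) 1, ‖P t‖ ≤ B * B := by
    intro t ht
    rw [hPt t ht]
    have hpt : ∀ y, ‖⟪g t y, vt t y⟫_ℝ‖ ≤ B * B := fun y =>
      (norm_inner_le_norm _ _).trans (mul_le_mul (hgB t ⟨ht.1, ht.2.le.trans one_le_two⟩ y)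
        (hB t ht y) (norm_nonneg _) hB0)
    calc ‖∫ y, ⟪g t y, vt t y⟫_ℝ‖ ≤ B * B * (volume : Measure (UnitAddTorus (Fin 2))).real univ :=
          norm_integral_le_of_norm_le_const (ae_of_all _ hpt)
      _ = B * B := by simp
  -- integrability on `(0,1)`
  have hint : IntegrableOn P (Ioo 0 1) volume := by
    refine IntegrableOn.of_bound (by rw [Real.volume_Ioo]; exact ENNReal.ofReal_lt_top)
      ((hPc.mono Ioo_subset_Ico_self).aestronglyMeasurable measurableSet_Ioo) (B * B) ?_
    exact (ae_restrict_iff' measurableSet_Ioo).2 (ae_of_all _ fun t ht => hPb t (Ioo_subset_Ico_self ht))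
  have hii : IntervalIntegrable P volume 0 1 :=
    (intervalIntegrable_iff_integrableOn_Ioo_of_le zero_le_one).2 hint
  refine ⟨hii, ?_⟩
  -- FTC on `[0, T]`, `T < 1`
  have hFTC : ∀ T ∈ Ioo (0 : ℝ) 1, ∫ t in Ioo 0 T, P t = K T - K 0 := by
    intro T hT
    have hTS : Icc 0 T ⊆ Ico (0 : ℝ) 1 := Icc_subset_Ico_right hT.2
    rw [← integral_Ioc_eq_integral_Ioo, ← intervalIntegral.integral_of_le hT.1.le,
      intervalIntegral.integral_eq_sub_of_hasDerivAt_of_le hT.1.le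
        (fun t ht => ((hK t (hTS ht)).continuousWithinAt.mono hTS))
        (fun t ht => (hK t (hTS (Ioo_subset_Icc_self ht))).hasDerivAt
          (mem_of_superset (Icc_mem_nhds ht.1 ht.2) hTS))
        ((hPc.mono ((uIcc_of_le hT.1.le).subset.trans hTS)).intervalIntegrable)]
  -- `K(T) → 0` as `T → 1⁻` and `K(0) = 0`
  have hK0 : K 0 = 0 := by
    simp only [hK_def, FunctionSpaces.Torus.kineticEnergy, hvt0, Pi.zero_apply, norm_zero, ne_eq,
      OfNat.ofNat_ne_zero, not_false_eq_true, zero_pow, integral_zero, mul_zero]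
  have hK1 : Tendsto K (𝓝[<] 1) (𝓝 0) := by
    have h := hvan.const_mul (2⁻¹ : ℝ)
    rw [mul_zero] at h
    exact h
  -- pass to the limit in the primitive
  have hintIcc : IntegrableOn P (Icc 0 1) volume := by
    rw [integrableOn_Icc_iff_integrableOn_Ioo]; exact hint
  have hF : ContinuousOn (fun x => ∫ t in Ioc 0 x, P t) (Icc 0 1) :=
    intervalIntegral.continuousOn_primitive hintIcc
  have hF1 : Tendsto (fun x => ∫ t in Ioc 0 x, P t) (𝓝[<] 1) (𝓝 (∫ t in Ioc 0 1, P t)) :=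
    (hF 1 ⟨zero_le_one, le_rfl⟩).tendsto.mono_left (nhdsWithin_le_of_mem (Icc_mem_nhdsLT one_pos))
  have hF2 : Tendsto (fun x => ∫ t in Ioc 0 x, P t) (𝓝[<] 1) (𝓝 (0 - 0)) := by
    refine ((hK1.sub_const (K 0)).congr' ?_).trans (by rw [hK0])
    filter_upwards [Ioo_mem_nhdsLT one_pos] with x hx
    rw [integral_Ioc_eq_integral_Ioo, hFTC x hx]
  rw [intervalIntegral.integral_of_le zero_le_one, tendsto_nhds_unique hF1 hF2, sub_zero]

/-- **Weak vanishing of the limit at the singular time**: `∫ ⟪u(t), w⟫ → 0` as `t → 1⁻` for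
every `w ∈ L²(T³; ℝ³)`, where `u(t) = (ṽ(t), ρ̃(t)) ∘ π` on `[0,1)` (Cheskidov 2023, (3.10):
"`u(t) ⇀ 0` weakly in `L²` as `t → 1⁻`"; here from `‖ṽ(t)‖_{L²} → 0` (Cauchy–Schwarz) and
`ρ̃(t) ⇀ 0` in `L²(T²)` (vanishing Fourier modes, lifted to `T³`)). [cite: Cheskidov2023, (3.10)] -/
theorem tendsto_integral_inner_limit (hprof : Torus.IsClassicalScalarTransportOn (Ico 0 1) 0 vt ρt)
    (hρt1 : ∀ t ∈ Ico (0 : ℝ) 1, ∫ y, ρt t y ^ 2 = 1)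
    (hvan : Tendsto (fun t => ∫ y, ‖vt t y‖ ^ 2) (𝓝[<] 1) (𝓝 0))
    (hρw : ∀ w : UnitAddTorus (Fin 2) → ℝ, MemLp w 2 volume →
      Tendsto (fun t => ∫ y, ρt t y * w y) (𝓝[<] 1) (𝓝 0))
    {w : UnitAddTorus (Fin 3) → EuclideanSpace ℝ (Fin 3)} (hw : MemLp w 2 volume) :
    Tendsto (fun t => ∫ x, ⟪(if t < 1 then twoHalf (vt t) (ρt t) else 0) x, w x⟫_ℝ) (𝓝[<] 1) (𝓝 0) := by
  classical
  have hV := hprof.smooth_velocity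
  have hev : ∀ᶠ t in 𝓝[<] (1 : ℝ), t ∈ Ico (0 : ℝ) 1 := Ico_mem_nhdsLT one_pos
  -- the horizontal part: Cauchy–Schwarz and `‖ṽ(t)‖_{L²} → 0`
  have h1 : Tendsto (fun t => ∫ x, ⟪twoHalf (vt t) 0 x, w x⟫_ℝ) (𝓝[<] 1) (𝓝 0) := by
    rw [tendsto_zero_iff_abs_tendsto_zero]
    have hsq : Tendsto (fun t => Real.sqrt (∫ y, ‖vt t y‖ ^ 2) * Real.sqrt (∫ x, ‖w x‖ ^ 2))
        (𝓝[<] 1) (𝓝 0) := by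
      have h := (Real.continuous_sqrt.tendsto 0).comp hvan
      rw [Function.comp_def, Real.sqrt_zero] at h
      simpa using h.mul_const (Real.sqrt (∫ x, ‖w x‖ ^ 2))
    refine tendsto_of_tendsto_of_tendsto_of_le_of_le' tendsto_const_nhds hsq
      (Eventually.of_forall fun t => abs_nonneg _) ?_
    filter_upwards [hev] with t ht
    have hVs : FunctionSpaces.Torus.IsSmooth (vt t) := hV.isSmooth_slice ht
    have hmem : MemLp (twoHalf (vt t) 0) 2 volume :=
      (hVs.twoHalf (FunctionSpaces.Torus.isSmooth_const (0 : ℝ))).memLp 2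
    refine (abs_integral_inner_le_sqrt_mul_sqrt hmem hw).trans_eq ?_
    rw [Torus.integral_norm_sq_twoHalf hVs.continuous continuous_zero]
    simp
  -- the vertical part: weak vanishing from vanishing Fourier modes
  have h2 : Tendsto (fun t => ∫ x, ⟪twoHalf 0 (ρt t) x, w x⟫_ℝ) (𝓝[<] 1) (𝓝 0) := by
    set r : ℝ → UnitAddTorus (Fin 2) → ℝ := fun t => if t ∈ Ico (0 : ℝ) 1 then ρt t else 0 with hr_def
    have hr_eq : ∀ t ∈ Ico (0 : ℝ) 1, r t = ρt t := fun t ht => if_pos ht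
    have hrs : ∀ t, FunctionSpaces.Torus.IsSmooth (r t) := fun t => by
      by_cases ht : t ∈ Ico (0 : ℝ) 1
      · rw [hr_eq t ht]; exact hprof.smooth_scalar.isSmooth_slice ht
      · rw [hr_def]; simp only [if_neg ht]; exact FunctionSpaces.Torus.isSmooth_const (0 : ℝ)
    have hrM : ∀ t, ∫ y, r t y ^ 2 ≤ 1 := fun t => by
      by_cases ht : t ∈ Ico (0 : ℝ) 1
      · rw [hr_eq t ht, hρt1 t ht]
      · have h0 : r t = 0 := if_neg ht
        rw [h0]
        simp
    have hcoef : ∀ k : Fin 2 → ℤ, Tendsto (fun t => mFourierCoeff (fun y => (r t y : ℂ)) k) (𝓝[<] 1) (𝓝 0) := by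
      refine Torus.tendsto_mFourierCoeff_of_tendsto_integral_mul (fun t => (hrs t).integrable) fun w' hw' => ?_
      refine (hρw w' (hw'.memLp_of_hasCompactSupport (HasCompactSupport.of_compactSpace _))).congr' ?_
      filter_upwards [hev] with t ht
      rw [hr_eq t ht]
    have h := Torus.tendsto_integral_inner_twoHalf_zero_left (l := 𝓝[<] (1 : ℝ)) (r := r) (M := 1)
      (fun t => (hrs t).memLp 2) hrM hcoef hw
    refine h.congr' ?_
    filter_upwards [hev] with t ht
    rw [hr_eq t ht]
  -- combine
  have h := h1.add h2
  rw [add_zero] at h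
  refine h.congr' ?_
  filter_upwards [hev] with t ht
  have hVs : FunctionSpaces.Torus.IsSmooth (vt t) := hV.isSmooth_slice ht
  have hRs : FunctionSpaces.Torus.IsSmooth (ρt t) := hprof.smooth_scalar.isSmooth_slice ht
  have hz' : FunctionSpaces.Torus.IsSmooth (0 : UnitAddTorus (Fin 2) → ℝ) := FunctionSpaces.Torus.isSmooth_const _
  have hz : FunctionSpaces.Torus.IsSmooth (0 : UnitAddTorus (Fin 2) → EuclideanSpace ℝ (Fin 2)) :=
    FunctionSpaces.Torus.isSmooth_const _
  have i1 : Integrable (fun x => ⟪twoHalf (vt t) 0 x, w x⟫_ℝ) volume :=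
    integrable_inner_of_memLp ((hVs.twoHalf hz').memLp 2) hw
  have i2 : Integrable (fun x => ⟪twoHalf 0 (ρt t) x, w x⟫_ℝ) volume :=
    integrable_inner_of_memLp ((hz.twoHalf hRs).memLp 2) hw
  rw [if_pos ht.2, Torus.twoHalf_eq_add (vt t) (ρt t)]
  simp_rw [Pi.add_apply, inner_add_left]
  exact (integral_add i1 i2).symm

/-- **The limit is a weak Euler solution on `[0,2]`** with force `f = (g, 0)` and datum
`u_in = (0, ρ_in) ∘ π` (Cheskidov 2023, §4 p. 12: `u(t) = (v(t), ρ(t))`, extended by zero after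
`t = 1`, "is a weak solution of the Euler equation with force `f = (g,0)` … and initial data
`u(0) = u_in = (0, ρ_in)` on the extended time interval `[0,2]`"), by the accepted
`Torus.isWeakNSSolutionForcedOn_of_vanishing` (classical on `[0,1)`, bounded, weakly vanishing as
`t → 1⁻`, zero afterwards, the force vanishing on `[1,2]`). [cite: Cheskidov2023, §4 p. 12] -/
theorem isWeakNSSolutionForcedOn_limit {ρin : UnitAddTorus (Fin 2) → ℝ}
    (hprof : Torus.IsClassicalScalarTransportOn (Ico 0 1) 0 vt ρt)
    (hg : ∀ t ∈ Ico (0 : ℝ) 1, ∀ y, g t y =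
      FunctionSpaces.Torus.timeDerivWithin (Ico 0 1) vt t y + FunctionSpaces.Torus.convect (vt t) (vt t) y)
    (hg0 : ∀ t ∈ Icc (1 : ℝ) 2, g t = 0)
    (hB : ∀ t ∈ Ico (0 : ℝ) 1, ∀ y, ‖vt t y‖ ≤ B ∧ |ρt t y| ≤ 10)
    (hgB : ∀ t ∈ Icc (0 : ℝ) 2, ∀ y, ‖g t y‖ ≤ B)
    (hvt0 : vt 0 = 0) (hρt0 : ρt 0 = ρin)
    (hρt1 : ∀ t ∈ Ico (0 : ℝ) 1, ∫ y, ρt t y ^ 2 = 1)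
    (hvan : Tendsto (fun t => ∫ y, ‖vt t y‖ ^ 2) (𝓝[<] 1) (𝓝 0))
    (hρw : ∀ w : UnitAddTorus (Fin 2) → ℝ, MemLp w 2 volume →
      Tendsto (fun t => ∫ y, ρt t y * w y) (𝓝[<] 1) (𝓝 0)) :
    Torus.IsWeakNSSolutionForcedOn 2 0 (fun t => twoHalf (g t) 0) (twoHalf 0 ρin)
      (fun t => if t < 1 then twoHalf (vt t) (ρt t) else 0) := by
  have hB0 : 0 ≤ B := (norm_nonneg _).trans (hB 0 ⟨le_rfl, one_pos⟩ 0).1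
  have h := Torus.isWeakNSSolutionForcedOn_of_vanishing (T₁ := 1) (T := 2) (ν := 0) (C := B + 10)
    (u := fun t => if t < 1 then twoHalf (vt t) (ρt t) else 0) one_pos one_le_two
    (isClassicalNSSolutionOn_limit hprof hg)
    (fun t ht => if_neg (not_lt.2 ht.1))
    (fun t ht => by
      show twoHalf (g t) 0 = 0
      rw [hg0 t ⟨ht.1, ht.2.le⟩]
      exact FunctionSpaces.Torus.twoHalf_zero)
    (fun t ht x => by
      show ‖(if t < 1 then twoHalf (vt t) (ρt t) else 0) x‖ ≤ B + 10
      rw [if_pos ht.2]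
      exact (FunctionSpaces.Torus.norm_twoHalf_le _ _ x).trans (add_le_add (hB t ht _).1 (hB t ht _).2))
    (fun t ht x => by
      show ‖twoHalf (g t) 0 x‖ ≤ B + 10
      rw [Torus.norm_twoHalf_zero_right]
      have := hgB t ⟨ht.1, ht.2.le.trans one_le_two⟩ (planarProj x)
      linarith)
    (fun w hw => tendsto_integral_inner_limit hprof hρt1 hvan hρw (hw.memLp 2))
  have h0 : (if (0 : ℝ) < 1 then twoHalf (vt 0) (ρt 0) else 0) = twoHalf 0 ρin := by
    rw [if_pos one_pos, hvt0, hρt0]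
  rw [h0] at h
  exact h

end Limit

/-! ## Convergence of the family to the limit before the singular time -/

section Convergence

variable {ν : ℕ → ℝ} {v : ℕ → ℝ → UnitAddTorus (Fin 2) → EuclideanSpace ℝ (Fin 2)}
  {θ ρ : ℕ → ℝ → UnitAddTorus (Fin 2) → ℝ}
  {vt : ℝ → UnitAddTorus (Fin 2) → EuclideanSpace ℝ (Fin 2)} {ρt : ℝ → UnitAddTorus (Fin 2) → ℝ}

/-- **Strong convergence before the singular time**: `u^m → u` in `C([0,T]; L²)` for every
`T < 1` (Cheskidov 2023, Thm. 2.1: "`u^ν → u` in `C([0,t]; L²)`, `∀ t ∈ [0,1)`"; on `[0,T]` and for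
`m` large, `v^m = ṽ`, `ρ^m = ρ̃` ((3.4)–(3.5) versus (3.7)–(3.8)), so `u^m - u = (0, θ^m - ρ^m) ∘ π`
and `‖u^m(s) - u(s)‖_{L²} = ‖θ^m(s) - ρ^m(s)‖_{L²} ≤ sup_{[0,2]} → 0`, (4.20)). [cite: Cheskidov2023, Thm. 2.1 and (4.20)] -/
theorem tendsto_iSup_eLpNorm_family_sub_limit
    (hθ : ∀ m, Torus.IsClassicalScalarTransportOn (Icc 0 2) (ν m) (v m) (θ m))
    (hρ : ∀ m, Torus.IsClassicalScalarTransportOn (Icc 0 2) 0 (v m) (ρ m))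
    (hstat : ∀ T ∈ Ico (0 : ℝ) 1, ∃ m₁ : ℕ, ∀ m ≥ m₁, ∀ t ∈ Icc (0 : ℝ) T, v m t = vt t ∧ ρ m t = ρt t)
    (hL2 : Tendsto (fun m => ⨆ t ∈ Icc (0 : ℝ) 2, eLpNorm (θ m t - ρ m t) 2 volume) atTop (𝓝 0))
    {T : ℝ} (hT : T ∈ Ico (0 : ℝ) 1) :
    Tendsto (fun m => ⨆ s ∈ Icc (0 : ℝ) T, eLpNorm (twoHalf (v m s) (θ m s) -
      (if s < 1 then twoHalf (vt s) (ρt s) else 0)) 2 volume) atTop (𝓝 0) := by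
  obtain ⟨m₁, hm₁⟩ := hstat T hT
  refine tendsto_of_tendsto_of_tendsto_of_le_of_le' tendsto_const_nhds hL2
    (Eventually.of_forall fun _ => zero_le) ?_
  filter_upwards [eventually_ge_atTop m₁] with m hm
  refine iSup₂_le fun s hs => ?_
  have hs1 : s < 1 := hs.2.trans_lt hT.2
  have hs2 : s ∈ Icc (0 : ℝ) 2 := ⟨hs.1, hs1.le.trans one_le_two⟩
  obtain ⟨hv, hr⟩ := hm₁ m hm s hs
  rw [if_pos hs1, ← hv, ← hr, ← FunctionSpaces.Torus.twoHalf_sub, sub_self,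
    Torus.eLpNorm_twoHalf_zero_left (((hθ m).smooth_scalar.isSmooth_slice hs2).sub
      ((hρ m).smooth_scalar.isSmooth_slice hs2)).continuous.aestronglyMeasurable]
  exact le_iSup₂ (f := fun t (_ : t ∈ Icc (0 : ℝ) 2) => eLpNorm (θ m t - ρ m t) 2 volume) s hs2

/-- **Weak (indeed strong) convergence at times `t < 1`**: `∫ ⟪u^m(t), w⟫ → ∫ ⟪u(t), w⟫` for
every `w ∈ L²(T³; ℝ³)` (Cheskidov 2023, Thm. 2.1, `C_w([0,2]; L²)` convergence; for `t < 1` from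
the strong convergence `‖u^m(t) - u(t)‖_{L²} = ‖θ^m(t) - ρ^m(t)‖_{L²} → 0` and Cauchy–Schwarz). [cite: Cheskidov2023, Thm. 2.1] -/
theorem tendsto_integral_inner_family_of_lt_one
    (hθ : ∀ m, Torus.IsClassicalScalarTransportOn (Icc 0 2) (ν m) (v m) (θ m))
    (hρ : ∀ m, Torus.IsClassicalScalarTransportOn (Icc 0 2) 0 (v m) (ρ m))
    (hstat : ∀ T ∈ Ico (0 : ℝ) 1, ∃ m₁ : ℕ, ∀ m ≥ m₁, ∀ t ∈ Icc (0 : ℝ) T, v m t = vt t ∧ ρ m t = ρt t)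
    (hL2 : Tendsto (fun m => ⨆ t ∈ Icc (0 : ℝ) 2, eLpNorm (θ m t - ρ m t) 2 volume) atTop (𝓝 0))
    {t : ℝ} (ht : t ∈ Ico (0 : ℝ) 1) {w : UnitAddTorus (Fin 3) → EuclideanSpace ℝ (Fin 3)}
    (hw : MemLp w 2 volume) :
    Tendsto (fun m => ∫ x, ⟪twoHalf (v m t) (θ m t) x, w x⟫_ℝ) atTop
      (𝓝 (∫ x, ⟪(if t < 1 then twoHalf (vt t) (ρt t) else 0) x, w x⟫_ℝ)) := by
  have ht2 : t ∈ Icc (0 : ℝ) 2 := ⟨ht.1, ht.2.le.trans one_le_two⟩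
  obtain ⟨m₁, hm₁⟩ := hstat t ht
  have hθs : ∀ m, FunctionSpaces.Torus.IsSmooth (θ m t) := fun m => (hθ m).smooth_scalar.isSmooth_slice ht2
  have hρs : ∀ m, FunctionSpaces.Torus.IsSmooth (ρ m t) := fun m => (hρ m).smooth_scalar.isSmooth_slice ht2
  have hz : FunctionSpaces.Torus.IsSmooth (0 : UnitAddTorus (Fin 2) → EuclideanSpace ℝ (Fin 2)) :=
    FunctionSpaces.Torus.isSmooth_const _
  -- the error term `d_m = (0, θ^m(t) - ρ^m(t)) ∘ π` tends to zero in `L²`, hence weakly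
  have hε : Tendsto (fun m => eLpNorm (θ m t - ρ m t) 2 volume) atTop (𝓝 0) :=
    tendsto_of_tendsto_of_tendsto_of_le_of_le tendsto_const_nhds hL2 (fun _ => zero_le)
      (fun m => le_iSup₂ (f := fun s (_ : s ∈ Icc (0 : ℝ) 2) => eLpNorm (θ m s - ρ m s) 2 volume) t ht2)
  have hsqrt : Tendsto (fun m => Real.sqrt (∫ y, (θ m t - ρ m t) y ^ 2)) atTop (𝓝 0) := by
    have h := (ENNReal.tendsto_toReal ENNReal.zero_ne_top).comp hε
    rw [ENNReal.toReal_zero] at h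
    refine h.congr fun m => ?_
    rw [Function.comp_apply, eLpNorm_two_eq_ofReal_sqrt_integral_sq (((hθs m).sub (hρs m)).memLp 2),
      ENNReal.toReal_ofReal (Real.sqrt_nonneg _)]
  have hd : Tendsto (fun m => ∫ x, ⟪twoHalf 0 (θ m t - ρ m t) x, w x⟫_ℝ) atTop (𝓝 0) := by
    rw [tendsto_zero_iff_abs_tendsto_zero]
    have hup : Tendsto (fun m => Real.sqrt (∫ y, (θ m t - ρ m t) y ^ 2) * Real.sqrt (∫ x, ‖w x‖ ^ 2))
        atTop (𝓝 0) := by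
      simpa using hsqrt.mul_const (Real.sqrt (∫ x, ‖w x‖ ^ 2))
    refine tendsto_of_tendsto_of_tendsto_of_le_of_le tendsto_const_nhds hup (fun m => abs_nonneg _)
      (fun m => ?_)
    have hmem : MemLp (twoHalf 0 (θ m t - ρ m t)) 2 volume := (hz.twoHalf ((hθs m).sub (hρs m))).memLp 2
    refine (abs_integral_inner_le_sqrt_mul_sqrt hmem hw).trans_eq ?_
    rw [Torus.integral_norm_sq_twoHalf continuous_zero ((hθs m).sub (hρs m)).continuous]
    simp
  have h := (tendsto_const_nhds (x := ∫ x, ⟪(if t < 1 then twoHalf (vt t) (ρt t) else 0) x, w x⟫_ℝ)).add hd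
  rw [add_zero] at h
  refine h.congr' ?_
  filter_upwards [eventually_ge_atTop m₁] with m hm
  obtain ⟨hv, hr⟩ := hm₁ m hm t ⟨ht.1, le_rfl⟩
  have hVs : FunctionSpaces.Torus.IsSmooth (vt t) := by rw [← hv]; exact (hθ m).smooth_velocity.isSmooth_slice ht2
  have hRs : FunctionSpaces.Torus.IsSmooth (ρt t) := by rw [← hr]; exact hρs m
  have i1 : Integrable (fun x => ⟪twoHalf (vt t) (ρt t) x, w x⟫_ℝ) volume :=
    integrable_inner_of_memLp ((hVs.twoHalf hRs).memLp 2) hw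
  have i2 : Integrable (fun x => ⟪twoHalf 0 (θ m t - ρ m t) x, w x⟫_ℝ) volume :=
    integrable_inner_of_memLp ((hz.twoHalf ((hθs m).sub (hρs m))).memLp 2) hw
  have hdec : twoHalf (v m t) (θ m t) = twoHalf (vt t) (ρt t) + twoHalf 0 (θ m t - ρ m t) := by
    rw [← FunctionSpaces.Torus.twoHalf_add, add_zero, hv, ← hr, add_sub_cancel]
  rw [if_pos ht.2, hdec]
  simp_rw [Pi.add_apply, inner_add_left]
  rw [integral_add i1 i2]

end Convergence

end Literature.Analysis.FluidPDE.Cheskidov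

end
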